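import Mathlib

/-!
# SampleStreamWindowMoments — deterministic inequalities behind DEQ-A09C (pub-qadeq, unit deq-1)

HONEST FRAMING: instance-level adjudication of specific advantage claims; no claim about BQP vs BPP or the summit.

Receipts (sorry-free, elementary real-number inequalities) for the order/polynomial steps of
`DEQ-A09C.md` (Theorem C: fixed-window von Neumann–Ulam estimator under a correlated sample stream):
Lemma W.1(d),(e) (variance / no-hit algebra), W.2 (pre-phase Chebyshev constant), W.3(a) (ρ-bias constant),
W.4(i) (coin-step bias constant), W.6 (end-window miss constant), W.8/W.9 (bias budget, Chebyshev count,
median exponent).  The probabilistic content (conditional expectations, Chebyshev, Hoeffding domination)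
is NOT formalised here; only the arithmetic that the markdown proof delegates to "numerically".
No statement here is a cited Literature fact; nothing is imported by any Summit file.
-/

namespace Summit.QuantumAdvantage.Dequantization.SampleStreamWindowMoments

/-- W.1(d): from `a - R ≤ E N ≤ a + R` and `E N² ≤ a² + 4aR + 2R² + a + R` (with `0 ≤ R ≤ a`),
`Var N = E N² − (E N)² ≤ (a + R)(1 + 6R)`. -/
theorem window_var_algebra (a R μ q : ℝ) (_hR : 0 ≤ R) (hRa : R ≤ a) (hμ₁ : a - R ≤ μ) (_hμ₂ : μ ≤ a + R)
    (hq : q ≤ a ^ 2 + 4 * a * R + 2 * R ^ 2 + a + R) : q - μ ^ 2 ≤ (a + R) * (1 + 6 * R) := by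
  have h0 : 0 ≤ a - R := by linarith
  have h1 : (a - R) ^ 2 ≤ μ ^ 2 := by nlinarith [mul_le_mul hμ₁ hμ₁ h0 (le_trans h0 hμ₁)]
  nlinarith [sq_nonneg R]

/-- W.1(e): Chebyshev/Cantelli denominator step: `V/μ² ≤ (a+R)(1+6R)/(a−R)²` when `0 < a − R ≤ μ`, `0 ≤ V ≤ (a+R)(1+6R)`. -/
theorem window_miss_algebra (a R μ V : ℝ) (_hR : 0 ≤ R) (hRa : R < a) (hμ : a - R ≤ μ) (hV0 : 0 ≤ V)
    (hV : V ≤ (a + R) * (1 + 6 * R)) : V / μ ^ 2 ≤ (a + R) * (1 + 6 * R) / (a - R) ^ 2 := by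
  have hd : 0 < a - R := by linarith
  have hμpos : 0 < μ := lt_of_lt_of_le hd hμ
  have h1 : (a - R) ^ 2 ≤ μ ^ 2 := by nlinarith [mul_le_mul hμ hμ hd.le hμpos.le]
  have h2 : 0 < (a - R) ^ 2 := by positivity
  have h3 : 0 < μ ^ 2 := by positivity
  have hBnn : 0 ≤ (a + R) * (1 + 6 * R) / (a - R) ^ 2 := div_nonneg (by nlinarith) h2.le
  have hB : (a + R) * (1 + 6 * R) / (a - R) ^ 2 * (a - R) ^ 2 = (a + R) * (1 + 6 * R) :=
    div_mul_cancel₀ _ h2.ne'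
  rw [div_le_iff₀ h3]
  calc V ≤ (a + R) * (1 + 6 * R) := hV
    _ = (a + R) * (1 + 6 * R) / (a - R) ^ 2 * (a - R) ^ 2 := hB.symm
    _ ≤ (a + R) * (1 + 6 * R) / (a - R) ^ 2 * μ ^ 2 := mul_le_mul_of_nonneg_left h1 hBnn

/-- W.2: pre-phase Chebyshev constant. With `a = m_p/nnz ≥ 8(1+6R)/η̄²` (written `8(1+6R) ≤ η̄² a`) and `η̄ ≤ 1/320`,
the one-sub-estimate failure bound `(a+R)(1+6R)/((3/4) η̄ a)²` is `< 1/4`. -/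
theorem prephase_chebyshev_quarter (a R η : ℝ) (hR : 0 ≤ R) (hη0 : 0 < η) (hη : η ≤ 1 / 320)
    (h8 : 8 * (1 + 6 * R) ≤ η ^ 2 * a) : (a + R) * (1 + 6 * R) / ((3 / 4) * η * a) ^ 2 < 1 / 4 := by
  have hη2pos : 0 < η ^ 2 := by positivity
  have ha : 0 < a := by
    by_contra h
    have h' : a ≤ 0 := not_lt.mp h
    have : η ^ 2 * a ≤ 0 := mul_nonpos_of_nonneg_of_nonpos hη2pos.le h'
    nlinarith
  have hR48 : 48 * R ≤ η ^ 2 * a := by linarith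
  have hη2 : η ^ 2 ≤ 1 / 102400 := by nlinarith
  have hpos : 0 < ((3 / 4) * η * a) ^ 2 := by positivity
  rw [div_lt_iff₀ hpos]
  have e1 := mul_le_mul_of_nonneg_left h8 ha.le
  have e2 := mul_le_mul_of_nonneg_left h8 hR
  have e3 := mul_le_mul_of_nonneg_left hR48 (by positivity : (0:ℝ) ≤ η ^ 2 * a)
  have e4 := mul_le_mul_of_nonneg_right hη2 (by positivity : (0:ℝ) ≤ η ^ 2 * a ^ 2)
  have e5 : 0 < η ^ 2 * a ^ 2 := by positivity
  nlinarith [e1, e2, e3, e4, e5]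

/-- W.3(a): ρ-bias constant. If `ρ ∈ [1/(1+η̄), 1/(1−η̄)]` (denominators cleared) and the window drift is `η₀ ≤ η̄`,
then `|ρ − 1| + ρ η₀ ≤ 2η̄/(1−η̄)` (denominator cleared). -/
theorem rho_bias (η ρ η0 : ℝ) (hη0 : 0 ≤ η) (hη : η ≤ 1 / 2) (hρ1 : 1 ≤ ρ * (1 + η)) (hρ2 : ρ * (1 - η) ≤ 1)
    (_he0 : 0 ≤ η0) (he : η0 ≤ η) : (|ρ - 1| + ρ * η0) * (1 - η) ≤ 2 * η := by
  have hρpos : 0 < ρ := by nlinarith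
  by_cases h : 1 ≤ ρ
  · rw [abs_of_nonneg (by linarith)]
    nlinarith [mul_le_mul_of_nonneg_left he hρpos.le]
  · have h' : ρ < 1 := not_le.mp h
    rw [abs_of_neg (by linarith)]
    nlinarith [mul_le_mul_of_nonneg_left he hρpos.le, mul_nonneg hη0 hη0]

/-- W.4(i): coin-step bias constant: two factors each within relative error `t` give relative error `≤ t(2+t)`. -/
theorem coin_bias (x y t : ℝ) (_ht : 0 ≤ t) (hx : |x| ≤ t) (hy : |y| ≤ t) :
    |(1 + x) * (1 + y) - 1| ≤ t * (2 + t) := by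
  rw [abs_le] at hx hy ⊢
  obtain ⟨hx1, hx2⟩ := hx
  obtain ⟨hy1, hy2⟩ := hy
  have p1 := mul_nonneg (by linarith : 0 ≤ t + x) (by linarith : 0 ≤ t + y)
  have p2 := mul_nonneg (by linarith : 0 ≤ t - x) (by linarith : 0 ≤ t - y)
  have p3 := mul_nonneg (by linarith : 0 ≤ t - x) (by linarith : 0 ≤ t + y)
  have p4 := mul_nonneg (by linarith : 0 ≤ t + x) (by linarith : 0 ≤ t - y)
  constructor <;> nlinarith [p1, p2, p3, p4]

/-- W.6: end-window miss constant. With `a_e = m_e/N ≥ 4(1+6R)/η̄` (written `4(1+6R) ≤ η̄ a`) and `η̄ ≤ 1/320`: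
`(a+R)(1+6R)/(a−R)² ≤ η̄/3`. -/
theorem end_miss_third (a R η : ℝ) (hR : 0 ≤ R) (hη0 : 0 < η) (hη : η ≤ 1 / 320)
    (h4 : 4 * (1 + 6 * R) ≤ η * a) : (a + R) * (1 + 6 * R) / (a - R) ^ 2 ≤ η / 3 := by
  have ha : 0 < a := by
    by_contra h
    have h' : a ≤ 0 := not_lt.mp h
    have : η * a ≤ 0 := mul_nonpos_of_nonneg_of_nonpos hη0.le h'
    nlinarith
  have hsmall : η * a ≤ a / 320 := by nlinarith [mul_le_mul_of_nonneg_right hη ha.le]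
  have hR24 : 24 * R ≤ η * a := by linarith
  have hRa : R ≤ a / 7680 := by linarith
  have hd : 0 < a - R := by linarith
  have hpos : 0 < (a - R) ^ 2 := by positivity
  rw [div_le_iff₀ hpos]
  have e1 := mul_le_mul_of_nonneg_left h4 (by linarith : (0:ℝ) ≤ a + R)
  have e2 := mul_le_mul_of_nonneg_left hRa (by positivity : (0:ℝ) ≤ η * a)
  have e3 : 0 ≤ η * a ^ 2 := by positivity
  have e4 : 0 ≤ η * R ^ 2 := by positivity
  nlinarith [e1, e2, e3, e4]

/-- W.8/W.9(iv): the replica-bias budget: `8.2/320 ≤ 1/32` and `1/32 + 1/64 < 1/16`. -/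
theorem replica_bias_budget : (8.2 : ℝ) / 320 ≤ 1 / 32 ∧ (1 : ℝ) / 32 + 1 / 64 < 1 / 16 := by
  constructor <;> norm_num

/-- W.9(ii): Chebyshev count: `n₀ ≥ 4096 C/ε²` gives `256 C/(n₀ ε²) ≤ 1/16`. -/
theorem chebyshev_count (C ε n : ℝ) (hC : 0 < C) (hε : 0 < ε) (hn : 4096 * C / ε ^ 2 ≤ n) :
    256 * C / (n * ε ^ 2) ≤ 1 / 16 := by
  have hε2 : 0 < ε ^ 2 := by positivity
  have hn' : 4096 * C ≤ n * ε ^ 2 := by rwa [div_le_iff₀ hε2] at hn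
  have hnpos : 0 < n * ε ^ 2 := by nlinarith
  rw [div_le_iff₀ hnpos]
  nlinarith

/-- W.9(iii) (and W.2 with 1/4 in place of 3/8): the median step. With conditional failure probability `≤ 1/8`
per group and `W ≥ 8 ln(2/δ)` groups, the Hoeffding bound `exp(−2W(1/2−1/8)²) = exp(−9W/32)` is `≤ δ/2`. -/
theorem median_exponent (δ W : ℝ) (hδ0 : 0 < δ) (hδ : δ ≤ 2) (hW : 8 * Real.log (2 / δ) ≤ W) :
    Real.exp (-(2 * W * (1 / 2 - 1 / 8) ^ 2)) ≤ δ / 2 := by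
  have hq : 0 < 2 / δ := by positivity
  have hlog : 0 ≤ Real.log (2 / δ) := Real.log_nonneg (by rw [le_div_iff₀ hδ0]; linarith)
  have h1 : -(2 * W * (1 / 2 - 1 / 8) ^ 2) ≤ -Real.log (2 / δ) := by nlinarith
  calc Real.exp (-(2 * W * (1 / 2 - 1 / 8) ^ 2)) ≤ Real.exp (-Real.log (2 / δ)) := Real.exp_le_exp.mpr h1
    _ = (2 / δ)⁻¹ := by rw [Real.exp_neg, Real.exp_log hq]
    _ = δ / 2 := by rw [inv_div]

/-- The pre-phase version: failure `≤ 1/4` per sub-estimate, `J ≥ 8 ln(2/δ)` sub-estimates: `exp(−2J(1/4)²) = exp(−J/8) ≤ δ/2`. -/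
theorem prephase_exponent (δ J : ℝ) (hδ0 : 0 < δ) (hδ : δ ≤ 2) (hJ : 8 * Real.log (2 / δ) ≤ J) :
    Real.exp (-(2 * J * (1 / 4) ^ 2)) ≤ δ / 2 := by
  have hq : 0 < 2 / δ := by positivity
  have hlog : 0 ≤ Real.log (2 / δ) := Real.log_nonneg (by rw [le_div_iff₀ hδ0]; linarith)
  have h1 : -(2 * J * (1 / 4) ^ 2) ≤ -Real.log (2 / δ) := by nlinarith
  calc Real.exp (-(2 * J * (1 / 4) ^ 2)) ≤ Real.exp (-Real.log (2 / δ)) := Real.exp_le_exp.mpr h1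
    _ = (2 / δ)⁻¹ := by rw [Real.exp_neg, Real.exp_log hq]
    _ = δ / 2 := by rw [inv_div]

/-- η̄ ≤ 1/320: `η̄ = ε/(320 D³ γ^(2D−2) s m̂₁)` with `ε ≤ 1` and the other factors `≥ 1` (abstracted as one factor `F ≥ 1`). -/
theorem etabar_small (ε F : ℝ) (_hε0 : 0 ≤ ε) (hε : ε ≤ 1) (hF : 1 ≤ F) : ε / (320 * F) ≤ 1 / 320 := by
  rw [div_le_iff₀ (by positivity)]
  nlinarith

end Summit.QuantumAdvantage.Dequantization.SampleStreamWindowMoments
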